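import Literature.AnabelianGeometry.EtaleTheta.Discharge.Sec5TorsionRootsAreUnits
import Literature.AnabelianGeometry.EtaleTheta.Discharge.Sec3Thm37Units

/-!
# [EtTh] Thm 5.7 / Lemma 5.8: the unit `ũ_N ∈ O^×(B_N)` OVER a unit `u ∈ O^×(B)` along the degree-`N` isometry `β : B_N → B`
# (abc-iut-L2-d4's binder `hroot₁N`) — PRODUCED from, and EQUIVALENT to, an `N`-th root of `β^*(u)` in `O^×(B_N^birat)`

Mochizuki, *The étale theta function and its Frobenioid-theoretic manifestations*, Publ. RIMS **45** (2009), Thm 5.7 p.329–330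
(PDF pp.103–104: "up to possible multiplication by a `2l`-th root of unity"), Lemma 5.8 p.331 (PDF p.105): "`(K^×)^{1/N} ⊆ O^×(B_N^birat)`
… `(K^×)^{1/N}/μ_N(B_N) ⥲ K^×`"; §1 p.240 (PDF p.14): "`J_N := K_N(a^{1/N})_{a ∈ K_N}`"; [FrdI] Thm 5.2 (i)/(ii) p.100–101 (the model
Frobenioid: morphisms `(deg_Fr, Base, Div, u_φ)`, composition `u_{ψ∘φ} = Base(φ)^*(u_ψ) · u_φ^{deg_Fr ψ}`, `O^×(A) ↪ O^×(A^birat)`).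
[cite: MochizukiEtTh2009, Lem 5.8 p.331 (PDF p.105)] [cite: MochizukiFrdI2008, Thm. 5.2(ii) p.101]

abc-iut cell, layer L2, row **R231** «`hroot₁N` PRODUCER at the genuine data» (abc-iut-L2-lead ROWS #14, seat abc-iut-f-123 gen 2).
PROOF-ONLY over L1's `ModelFrobenioidUnits.lean` (`unitAut`, `units`), abc-iut-L2-t3's `BiKummerRoots.lean` (`NthRoot`: `β : B_N → B`,
"`α, β` are isometries of Frobenius degree `N`"), abc-iut-L2-t4's `Discharge/Sec5TorsionRootsAreUnits.lean` (torsion-freeness of `Φ^gp`).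
The binder (abc-iut-f-121 10:55:31Z, verbatim): `ut : Aut (R N).BN`, `hut : ut ∈ S.units (R N).BN`, `hover : ut.hom ≫ (R N).β = (R N).β ≫ u.hom`.

WHAT IS PROVED.
* §1 (any model Frobenioid, [FrdI] Thm 5.2 (i) composition law): `ModelFrobenioid.unit_comp_eq_comp_unit_of_pow_eq` — a unit `σ` of `X`
  INTERTWINES a unit `τ` of `Y` along `φ : X ⟶ Y` (`σ ≫ φ = φ ≫ τ`) as soon as `u_σ^{deg_Fr φ} = Base(φ)^*(u_τ)` (and `Div σ = Div τ = 0`) —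
  the degree-`d` twin of L1's `comp_eq_unitsPull_comp` (`d = 1`); `ModelFrobenioid.exists_unit_over_of_root` — from a birational unit
  `r ∈ B(X_D)^×` with `r^{deg_Fr φ} = Base(φ)^*(u_τ)` and `Φ(X_D)^gp` torsion-free, the unit `(1, id, 0, r) ∈ O^×(X)` over `τ` (its
  `Div_B` vanishes: `N · Div_B(r) = Div_B(Base(φ)^* u_τ) = 0`); NECESSITY `ModelFrobenioid.unit_pow_eq_of_comp_eq` — conversely any unit over
  `τ` has `u_σ^{deg_Fr φ} = Base(φ)^*(u_τ)` (`B` group-like).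
* §2 (every `S : BiKummerSetting`, whose `C` IS a model Frobenioid): **`BiKummerSetting.NthRoot.exists_unit_over_of_root`** — for an `N`-th root
  `R` (so `deg_Fr β = N`), a unit `u ∈ O^×(B)` with `Div u = 0` and a birational unit `r ∈ O^×(B_N^birat)` with `r^N = Base(β)^*(u_u)`:
  `∃ ut ∈ O^×(B_N), ut ≫ β = β ≫ u` — EXACTLY the `hroot₁N` binder — and **`unit_pow_eq_of_hover`**: every such `ut` has `u_{ut}^N = Base(β)^*(u_u)`.
  So `hroot₁N` ⟺ «`Base(β)^*(u)` is an `N`-th power in `O^×(B_N^birat)`».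
* §3 (settings whose `tf` satisfies [FrdI] Thm 5.2's hypotheses `h` with `Φ` perfect `hP` — the GENUINE data
  `S := mkOfConnectedTemperoid X tf hZ hP …`, `S.tf = tf` by `rfl`): `Div u = 0` and the torsion-freeness are THEOREMS (`Φ(B_N^bs)` divisorial
  hence sharp, perfect + integral hence `Φ^gp` torsion-free — abc-iut-L2-t4's `isTorsionFree_grothendieckGroup_of_isPerfect`), leaving
  **`NthRoot.exists_hroot₁N_of_root`** / **`hroot₁N_iff_exists_root`**: `hroot₁N` ⟸ (indeed ⟺) the ONE input
  «`∃ r ∈ O^×(B_N^birat), r^N = Base(β)^*(u)`» — Lemma 5.8's surjectivity "`(K^×)^{1/N}/μ_N(B_N) ⥲ K^×`" AT the constant `u` (in print `u`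
  is a `2l`-th root of unity, Thm 5.7, and `B_N` lies over `J_{lN} ⊇ K_{lN}((K_{lN}^×)^{1/lN})`, §1 p.240) = the printed input (hsurj) of
  abc-iut-L2-t4's `kxRootNModCyclotome_ofConnectedTemperoidData_of_surj`, which the abstract rational-function stub `VD` cannot supply.
* §5 (v2): `IsFixedByHA` is closed under `1`, products, inverses; `isFixedByHA_of_mul_eq` — abc-iut-f-121's companion clause `hfix` for the
  twisted function `f′` (`f′ · c = f`) REDUCES to the fixedness of `f` (in hand) and of the pulled-back constant `c` (same source as G-f123-1).
HONEST FRAMING: kernel-checked [FrdI] bookkeeping; the root-existence input is NOT discharged here (GAP-LEDGER row of record); refereed pre-IUT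
material; nothing here bears on [IUTchIII] Cor. 3.12 or takes a side; typed ≠ proved for the genuine datum.
-/

noncomputable section

open CategoryTheory Opposite

/-! ## §1. Model Frobenioids: units over units along a morphism of Frobenius degree `d` -/

namespace Literature.AlgebraicGeometry.Frobenioids.ModelFrobenioid

universe w v u

variable {D : Type u} [Category.{v} D] {Φ B : Dᵒᵖ ⥤ CommMonCat.{w}} {DivB : B ⟶ monoidGp Φ}

/-- **Degree-`d` intertwining** ([FrdI] Thm 5.2 (i) composition law): for `φ : X ⟶ Y`, a unit `σ ∈ O^×(X)` and a unit `τ ∈ O^×(Y)` with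
`Div σ = Div τ = 0`, if `u_σ ^ deg_Fr(φ) = Base(φ)^*(u_τ)` in `B(X_D)` then `σ ≫ φ = φ ≫ τ` (print: `φ ∘ ũ = u ∘ φ`).  For `deg_Fr φ = 1`
this is L1's `comp_eq_unitsPull_comp`.  [cite: MochizukiFrdI2008, Thm. 5.2(i) p.100] -/
theorem unit_comp_eq_comp_unit_of_pow_eq {X Y : ModelFrobenioid Φ B DivB} (φ : X ⟶ Y) {σ : Aut X} (hσ : σ ∈ units X)
    {τ : Aut Y} (hτ : τ ∈ units Y) (hdσ : div σ.hom = 1) (hdτ : div τ.hom = 1)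
    (hu : unit σ.hom ^ (degFr φ : ℕ) = (B.map (baseMap φ).op).hom (unit τ.hom)) :
    σ.hom ≫ φ = φ ≫ τ.hom := by
  apply hom_ext
  · rw [degFr_comp, degFr_comp, hσ.2, hτ.2, mul_one, one_mul]
  · rw [baseMap_comp, baseMap_comp, hσ.1, hτ.1, Category.id_comp, Category.comp_id]
  · simp only [div_comp, hσ.1, hdσ, hdτ, hτ.2, map_id_apply_Φ, one_pow, mul_one, map_one, one_mul, PNat.one_coe, pow_one]
  · simp only [unit_comp, hσ.1, hτ.2, map_id_apply_B, hu, PNat.one_coe, pow_one]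
    exact mul_comm _ _

/-- **NECESSITY**: if a unit `σ ∈ O^×(X)` lies over `τ ∈ O^×(Y)` along `φ` (`σ ≫ φ = φ ≫ τ`) then `u_σ ^ deg_Fr(φ) · u_φ = Base(φ)^*(u_τ) · u_φ`;
hence `u_σ ^ deg_Fr(φ) = Base(φ)^*(u_τ)` when `u_φ` is a unit of `B(X_D)` (`B` group-like, [FrdI] Thm 5.2).
[cite: MochizukiFrdI2008, Thm. 5.2(i) p.100] -/
theorem unit_pow_eq_of_comp_eq {X Y : ModelFrobenioid Φ B DivB} (φ : X ⟶ Y) {σ : Aut X} (hσ : σ ∈ units X)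
    {τ : Aut Y} (hτ : τ ∈ units Y) (h : σ.hom ≫ φ = φ ≫ τ.hom) (hφ : IsUnit (unit φ)) :
    unit σ.hom ^ (degFr φ : ℕ) = (B.map (baseMap φ).op).hom (unit τ.hom) := by
  have hu := congrArg unit h
  rw [unit_comp, unit_comp, hσ.1, hτ.2, map_id_apply_B, PNat.one_coe, pow_one, mul_comm] at hu
  exact hφ.mul_right_cancel hu

/-- `Div_B` of a `d`-th root of `Base(φ)^*(u_τ)` is `d`-torsion: `Div_B(r)^d = Φ(Base φ)(Div τ) = 0` for `τ ∈ O^×(Y)` with `Div τ = 0`.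
[cite: MochizukiFrdI2008, Thm. 5.2(ii) p.101] -/
theorem divB_pow_eq_one_of_pow_eq {X Y : ModelFrobenioid Φ B DivB} (φ : X ⟶ Y) {τ : Aut Y} (hτ : τ ∈ units Y)
    (hdτ : div τ.hom = 1) {r : B.obj (op X.base)} {d : ℕ} (hr : r ^ d = (B.map (baseMap φ).op).hom (unit τ.hom)) :
    divB Φ B DivB (op X.base) r ^ d = 1 := by
  rw [← map_pow, hr, ← pullGp_divB, ← of_div_eq_divB_unit_of_mem_units hτ, hdτ, map_one, map_one]

/-- **EXISTENCE of the unit over `τ`** ([FrdI] Thm 5.2 (ii) "`O^×(A) ↪ O^×(A^birat)`" + the degree-`d` law): if `Φ(X_D)^gp` is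
torsion-free, `τ ∈ O^×(Y)` has `Div τ = 0`, and `r ∈ B(X_D)^×` is a `deg_Fr(φ)`-th root of `Base(φ)^*(u_τ)`, then the base-identity linear
automorphism `σ := (1, id, 0, r) ∈ O^×(X)` lies over `τ`: `σ ≫ φ = φ ≫ τ`, with `u_σ = r`.
[cite: MochizukiFrdI2008, Thm. 5.2(ii) p.101] -/
theorem exists_unit_over_of_root {X Y : ModelFrobenioid Φ B DivB} (φ : X ⟶ Y)
    (htf : IsTorsionFree (Algebra.GrothendieckGroup (Φ.obj (op X.base)))) {τ : Aut Y} (hτ : τ ∈ units Y)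
    (hdτ : div τ.hom = 1) (r : (B.obj (op X.base))ˣ)
    (hr : (r : B.obj (op X.base)) ^ (degFr φ : ℕ) = (B.map (baseMap φ).op).hom (unit τ.hom)) :
    ∃ σ : Aut X, σ ∈ units X ∧ unit σ.hom = r ∧ σ.hom ≫ φ = φ ≫ τ.hom := by
  have hdiv : divB Φ B DivB (op X.base) (r : B.obj (op X.base)) = 1 :=
    htf.eq_one_of_pow_eq_one _ _ (degFr φ).pos (divB_pow_eq_one_of_pow_eq φ hτ hdτ hr)
  have hdiv' : divB Φ B DivB (op X.base) ((r⁻¹ : (B.obj (op X.base))ˣ) : B.obj (op X.base)) = 1 := by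
    have h := congrArg (divB Φ B DivB (op X.base)) r.inv_mul
    rw [map_mul, map_one, hdiv, mul_one] at h
    exact h
  have h : Algebra.GrothendieckGroup.of (1 : Φ.obj (op X.base)) = divB Φ B DivB (op X.base) (r : B.obj (op X.base)) := by
    rw [map_one, hdiv]
  have h' : Algebra.GrothendieckGroup.of (1 : Φ.obj (op X.base)) =
      divB Φ B DivB (op X.base) ((r⁻¹ : (B.obj (op X.base))ˣ) : B.obj (op X.base)) := by
    rw [map_one, hdiv']
  refine ⟨unitAut X 1 1 (r : B.obj (op X.base)) ((r⁻¹ : (B.obj (op X.base))ˣ) : B.obj (op X.base)) h h' (one_mul 1)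
    (by exact_mod_cast r.inv_mul), unitAut_mem_units X 1 1 _ _ h h' _ _, rfl, ?_⟩
  exact unit_comp_eq_comp_unit_of_pow_eq φ (unitAut_mem_units X 1 1 _ _ h h' _ _) hτ rfl hdτ hr

end Literature.AlgebraicGeometry.Frobenioids.ModelFrobenioid

/-! ## §2. Every `BiKummerSetting`: the `hroot₁N` binder ⟺ an `N`-th root of `Base(β)^*(u)` in `O^×(B_N^birat)` -/

namespace Literature.AnabelianGeometry.EtaleTheta

open Literature.AlgebraicGeometry.Frobenioids

namespace BiKummerSetting

universe u₀ v₀ u v w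

variable {K : Type u₀} [Field K] {X : SemiGraphs.TemperedArithmeticGroup.{u₀} K} {D₀ : Type u₀} [Category.{v₀} D₀]
  {V : FrdIMonoidStub.{w}} {T : RealifiedDivisorMonoids (D₀ := D₀) V} {D : Type u} [Category.{v} D]
  {VD : FrdICatStub.{u, v, w} D} {S : BiKummerSetting X T D VD}

/-- `O^×(A)` of the setting IS L1's `ModelFrobenioid.units A` (abc-iut-w6-d048's `unitsSubgroup_toElem_eq_units`).
[cite: MochizukiEtTh2009, Def 4.1 p.313 (PDF p.87)] -/
theorem mem_units_iff_model {A : S.C} (σ : Aut A) : σ ∈ S.units A ↔ σ ∈ ModelFrobenioid.units A := by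
  rw [← TemperedFrobenioid.unitsSubgroup_toElem_eq_units]

namespace NthRoot

variable {A B : S.C} {f : S.biratUnits A} {P : S.FractionPair f B} {N : ℕ+}
  {pullFrac : ∀ {A' : S.C} (_ : A' ⟶ A), S.biratUnits A → S.biratUnits A'} (R : S.NthRoot f P N pullFrac)

/-- `deg_Fr(β) = N` for an `N`-th root, in L1's model-Frobenioid currency. [cite: MochizukiEtTh2009, Prop 4.2 (iii) p.314 (PDF p.88)] -/
theorem model_degFr_β : ModelFrobenioid.degFr R.β = N := R.isIsometry.2.2.2

/-- **`hroot₁N` PRODUCED (every `BiKummerSetting`).**  Let `R = (A_N, B_N, α, β, …)` be an `N`-th root, `u ∈ O^×(B)` a unit with `Div u = 0`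
(automatic for divisorial `Φ`), `Φ(B_N^bs)^gp` torsion-free (automatic for perfect divisorial `Φ`), and `r ∈ O^×(B_N^birat)` a birational unit
with `r^N = Base(β)^*(u_u)` — an `N`-th root of the constant read on `B_N`.  Then there is `ũ ∈ O^×(B_N)` OVER `u`: `ũ ≫ β = β ≫ u` —
abc-iut-L2-d4's binder `hroot₁N` in abc-iut-f-121's exact shape — with `u_ũ = r`.  [cite: MochizukiEtTh2009, Lem 5.8 p.331 (PDF p.105)] -/
theorem exists_unit_over_of_root (u : Aut B) (hu : u ∈ S.units B) (hdu : ModelFrobenioid.div u.hom = 1)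
    (htf : IsTorsionFree (Algebra.GrothendieckGroup (S.tf.divisorMonoid.obj (op R.BN.base))))
    (r : (S.tf.ratFnFunctor.obj (op R.BN.base))ˣ)
    (hr : (r : S.tf.ratFnFunctor.obj (op R.BN.base)) ^ (N : ℕ) =
      (S.tf.ratFnFunctor.map (ModelFrobenioid.baseMap R.β).op).hom (ModelFrobenioid.unit u.hom)) :
    ∃ ut : Aut R.BN, ut ∈ S.units R.BN ∧ ModelFrobenioid.unit ut.hom = r ∧ ut.hom ≫ R.β = R.β ≫ u.hom := by
  have hr' : (r : S.tf.ratFnFunctor.obj (op R.BN.base)) ^ (ModelFrobenioid.degFr R.β : ℕ) =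
      (S.tf.ratFnFunctor.map (ModelFrobenioid.baseMap R.β).op).hom (ModelFrobenioid.unit u.hom) := by
    rw [R.model_degFr_β]; exact hr
  obtain ⟨σ, hσ, hσr, hσc⟩ :=
    ModelFrobenioid.exists_unit_over_of_root R.β htf ((mem_units_iff_model u).mp hu) hdu r hr'
  exact ⟨σ, (mem_units_iff_model σ).mpr hσ, hσr, hσc⟩

/-- **NECESSITY (every `BiKummerSetting`)**: a unit `ũ ∈ O^×(B_N)` over `u ∈ O^×(B)` along `β` (`ũ ≫ β = β ≫ u`) has
`u_ũ^N = Base(β)^*(u_u)` in `O^×(B_N^birat)` — provided `u_β` is a unit of `B(B_N^bs)` (`B` group-like, [FrdI] Thm 5.2).  So `hroot₁N` holds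
IFF `Base(β)^*(u_u)` is an `N`-th power of a birational unit of `B_N` with vanishing `Div_B` (Lemma 5.8's `(K^×)^{1/N}`).
[cite: MochizukiEtTh2009, Lem 5.8 p.331 (PDF p.105)] -/
theorem unit_pow_eq_of_hover (u : Aut B) (hu : u ∈ S.units B) (ut : Aut R.BN) (hut : ut ∈ S.units R.BN)
    (hover : ut.hom ≫ R.β = R.β ≫ u.hom) (hβ : IsUnit (ModelFrobenioid.unit R.β)) :
    ModelFrobenioid.unit ut.hom ^ (N : ℕ) =
      (S.tf.ratFnFunctor.map (ModelFrobenioid.baseMap R.β).op).hom (ModelFrobenioid.unit u.hom) := by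
  have key := ModelFrobenioid.unit_pow_eq_of_comp_eq R.β ((mem_units_iff_model ut).mp hut) ((mem_units_iff_model u).mp hu) hover hβ
  rw [R.model_degFr_β] at key
  exact key

end NthRoot

/-! ## §3. Settings whose tempered Frobenioid satisfies [FrdI] Thm 5.2's hypotheses with `Φ` perfect — e.g. the GENUINE data
`mkOfConnectedTemperoid X tf hZ hP …` (abc-iut-L2-t4; `S.tf = tf` definitionally): torsion-freeness and `Div u = 0` discharged -/

section Genuine

variable (h : ModelFrobenioid.Hypotheses S.tf.divisorMonoid S.tf.ratFnFunctor)
  (hP : ∀ A : Dᵒᵖ, IsPerfect (S.tf.Φ.carrier A))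

include h in
/-- Under [FrdI] Thm 5.2's hypotheses a unit has `Div = 0` (`Φ` divisorial hence sharp).
[cite: MochizukiEtTh2009, Def 3.6 p.302 (PDF p.76)] -/
theorem div_eq_one_of_mem_units_of_hypotheses {Y : S.C} {u : Aut Y} (hu : u ∈ S.units Y) : ModelFrobenioid.div u.hom = 1 :=
  ModelFrobenioid.div_eq_one_of_mem_units (h.isDivisorial Y.base).isSharp ((mem_units_iff_model u).mp hu)

include h hP in
/-- Under [FrdI] Thm 5.2's hypotheses with `Φ` perfect, `Φ(A^bs)^gp` is torsion-free (abc-iut-L2-t4's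
`isTorsionFree_grothendieckGroup_of_isPerfect`; Prop 5.1 "`Φ` perfect").  [cite: MochizukiEtTh2009, Prop 5.1 p.323 (PDF p.97)] -/
theorem isTorsionFree_divisorMonoidGp_of_hypotheses (Y : S.C) :
    IsTorsionFree (Algebra.GrothendieckGroup (S.tf.divisorMonoid.obj (op Y.base))) :=
  isTorsionFree_grothendieckGroup_of_isPerfect (hP (op Y.base)) (h.isDivisorial Y.base).isPreDivisorial.isIntegral

namespace NthRoot

variable {A B : S.C} {f : S.biratUnits A} {P : S.FractionPair f B} {N : ℕ+}
  {pullFrac : ∀ {A' : S.C} (_ : A' ⟶ A), S.biratUnits A → S.biratUnits A'} (R : S.NthRoot f P N pullFrac)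

include h hP in
/-- **R231 — `hroot₁N` at the GENUINE data, from the ONE printed input**: at any setting whose tempered Frobenioid satisfies [FrdI] Thm 5.2's
hypotheses `h` with `Φ` perfect `hP` (abc-iut-L2-t4's `mkOfConnectedTemperoid X tf hZ hP …`, `S.tf = tf` by `rfl`), for every level-`N`
root `R` (abc-iut-L2-d4's `R N`), every unit `u ∈ O^×(B)` (abc-iut-w5-d245's discrepancy `D_p`) and every birational unit
`r ∈ O^×(B_N^birat)` with `r^N = Base(β)^*(u_u)` (Lemma 5.8: an `N`-th root of the constant exists on `B_N`, which lies over
`J_{lN} ⊇ K_{lN}((K_{lN}^×)^{1/lN})`, §1 p.240), there is `ũ ∈ O^×(B_N)` with `ũ ≫ β = β ≫ u` (and `u_ũ = r`).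
[cite: MochizukiEtTh2009, Lem 5.8 p.331 (PDF p.105)] -/
theorem exists_hroot₁N_of_root (u : Aut B) (hu : u ∈ S.units B) (r : (S.tf.ratFnFunctor.obj (op R.BN.base))ˣ)
    (hr : (r : S.tf.ratFnFunctor.obj (op R.BN.base)) ^ (N : ℕ) =
      (S.tf.ratFnFunctor.map (ModelFrobenioid.baseMap R.β).op).hom (ModelFrobenioid.unit u.hom)) :
    ∃ ut : Aut R.BN, ut ∈ S.units R.BN ∧ ModelFrobenioid.unit ut.hom = r ∧ ut.hom ≫ R.β = R.β ≫ u.hom :=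
  R.exists_unit_over_of_root u hu (div_eq_one_of_mem_units_of_hypotheses h hu)
    (isTorsionFree_divisorMonoidGp_of_hypotheses h hP R.BN) r hr

include h hP in
/-- **R231 — the residual is EXACT**: under `h`, `hP`, the binder `hroot₁N` (a unit of `B_N` over `u` along `β`) holds IFF `Base(β)^*(u_u)` is
an `N`-th power in `O^×(B_N^birat)` (`u_β` is a unit since `B` is group-like).  [cite: MochizukiEtTh2009, Lem 5.8 p.331 (PDF p.105)] -/
theorem hroot₁N_iff_exists_root (u : Aut B) (hu : u ∈ S.units B) :
    (∃ ut : Aut R.BN, ut ∈ S.units R.BN ∧ ut.hom ≫ R.β = R.β ≫ u.hom) ↔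
      ∃ r : (S.tf.ratFnFunctor.obj (op R.BN.base))ˣ, (r : S.tf.ratFnFunctor.obj (op R.BN.base)) ^ (N : ℕ) =
        (S.tf.ratFnFunctor.map (ModelFrobenioid.baseMap R.β).op).hom (ModelFrobenioid.unit u.hom) := by
  constructor
  · rintro ⟨ut, hut, hover⟩
    have hβ : IsUnit (ModelFrobenioid.unit R.β) := (h.isGroupLike_rat R.BN.base).isUnit _
    have hut' : IsUnit (ModelFrobenioid.unit ut.hom) := (h.isGroupLike_rat R.BN.base).isUnit _
    refine ⟨hut'.unit, ?_⟩
    rw [IsUnit.unit_spec]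
    exact R.unit_pow_eq_of_hover u hu ut hut hover hβ
  · rintro ⟨r, hr⟩
    obtain ⟨ut, hut, -, hover⟩ := R.exists_hroot₁N_of_root h hP u hu r hr
    exact ⟨ut, hut, hover⟩

end NthRoot

end Genuine

/-! ## §4. Literally at abc-iut-L2-t4's `mkOfConnectedTemperoid` (the consumers' `S`; `S.tf = tf` by `rfl`) -/

section Connected

open Literature.AnabelianGeometry.SemiGraphs Literature.AlgebraicGeometry.Frobenioids.QuasiTemperoid.BTempConnected

variable {X : SemiGraphs.TemperedArithmeticGroup.{u₀} K} {D₀ : Type u₀} [Category.{v₀} D₀] {V : FrdIMonoidStub.{w}}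
  {T₀ : RealifiedDivisorMonoids (D₀ := D₀) V} {VD : FrdICatStub.{u₀ + 1, u₀, w} (ConnectedPart (BTemp X.Pi))}
  {tf : TemperedFrobenioid T₀ (ConnectedPart (BTemp X.Pi)) VD} {hZ : tf.monoidType = MonoidType.Z}
  {hP : ∀ A : (ConnectedPart (BTemp X.Pi))ᵒᵖ, IsPerfect (tf.Φ.carrier A)}
  {NH : Subgroup (Field.absoluteGaloisGroup K) → tf.category → ℕ+ → Prop} {A₀ : tf.category}
  {hA₀ : PreFrobenioid.IsFrobeniusTrivial tf.toElem A₀} {hA₀' : SemiGraphs.IsGaloisObj A₀.base.obj}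
  {A B : (mkOfConnectedTemperoid X tf hZ hP NH A₀ hA₀ hA₀').C}
  {f : (mkOfConnectedTemperoid X tf hZ hP NH A₀ hA₀ hA₀').biratUnits A}
  {P : (mkOfConnectedTemperoid X tf hZ hP NH A₀ hA₀ hA₀').FractionPair f B} {N : ℕ+}
  {pullFrac : ∀ {A' : (mkOfConnectedTemperoid X tf hZ hP NH A₀ hA₀ hA₀').C} (_ : A' ⟶ A),
    (mkOfConnectedTemperoid X tf hZ hP NH A₀ hA₀ hA₀').biratUnits A → (mkOfConnectedTemperoid X tf hZ hP NH A₀ hA₀ hA₀').biratUnits A'}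
  (h : ModelFrobenioid.Hypotheses tf.divisorMonoid tf.ratFnFunctor)
  (R : (mkOfConnectedTemperoid X tf hZ hP NH A₀ hA₀ hA₀').NthRoot f P N pullFrac)

include h in
/-- **R231 at the genuine connected base `B^temp(Π^tp_X)⁰`** — the `hroot₁N` binder for `S := mkOfConnectedTemperoid X tf hZ hP …` from an
`N`-th root `r ∈ O^×(B_N^birat) = B(B_N^bs)^×` of `Base(β)^*(u_u)` (the inputs `h`, `hP` are the setting's own).
[cite: MochizukiEtTh2009, Lem 5.8 p.331 (PDF p.105)] -/
theorem exists_hroot₁N_mkOfConnectedTemperoid_of_root (u : Aut B) (hu : u ∈ (mkOfConnectedTemperoid X tf hZ hP NH A₀ hA₀ hA₀').units B)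
    (r : tf.biratUnitsModel R.BN)
    (hr : (r : tf.ratFnFunctor.obj (op R.BN.base)) ^ (N : ℕ) =
      (tf.ratFnFunctor.map (ModelFrobenioid.baseMap R.β).op).hom (ModelFrobenioid.unit u.hom)) :
    ∃ ut : Aut R.BN, ut ∈ (mkOfConnectedTemperoid X tf hZ hP NH A₀ hA₀ hA₀').units R.BN ∧
      ModelFrobenioid.unit ut.hom = (r : tf.ratFnFunctor.obj (op R.BN.base)) ∧ ut.hom ≫ R.β = R.β ≫ u.hom :=
  NthRoot.exists_hroot₁N_of_root (S := mkOfConnectedTemperoid X tf hZ hP NH A₀ hA₀ hA₀') h hP R u hu r hr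

end Connected

/-! ## §5 (v2, append-only). The companion clause `hfix`: `H_{A_N}`-fixedness bookkeeping (Def 4.1 (iii))

abc-iut-f-121's remaining clause for the twisted root is `hfix : S.IsFixedByHA (R N).AN _ (pullFrac α′ f′)` with
`f′ · c = f` for `c := (s″)^*(u_u)` (`fracOfModel_twistUnit_mul`).  Since `Aut_C(A)` acts on `O^×(A^birat)` by GROUP automorphisms
(`S.biratAut A σ : MulAut _`), fixedness is closed under products and inverses, so `hfix` REDUCES to the fixedness of `pullFrac α′ f`
(in hand: `R.isSaturated.fixed`) and of the pulled-back constant `pullFrac α′ c` — the SAME source as G-f123-1 (constants are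
`H`-invariant, Def 3.6 (iii) / Lemma 5.8).  Nothing about the genuine data is asserted. -/

section Fixed

variable {A : S.C} (hA : S.IsGalois A)

/-- `1 ∈ O^×(A^birat)` is `H_A`-fixed. [cite: MochizukiEtTh2009, Def 4.1 (iii) p.313 (PDF p.87)] -/
theorem isFixedByHA_one : S.IsFixedByHA A hA 1 := fun σ _ => map_one (S.biratAut A σ)

variable {hA}

/-- `H_A`-fixed birational units are closed under products. [cite: MochizukiEtTh2009, Def 4.1 (iii) p.313 (PDF p.87)] -/
theorem IsFixedByHA.mul {f g : S.biratUnits A} (hf : S.IsFixedByHA A hA f) (hg : S.IsFixedByHA A hA g) :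
    S.IsFixedByHA A hA (f * g) := fun σ hσ => by
  rw [map_mul, hf σ hσ, hg σ hσ]

/-- `H_A`-fixed birational units are closed under inverses. [cite: MochizukiEtTh2009, Def 4.1 (iii) p.313 (PDF p.87)] -/
theorem IsFixedByHA.inv {f : S.biratUnits A} (hf : S.IsFixedByHA A hA f) : S.IsFixedByHA A hA f⁻¹ := fun σ hσ => by
  rw [map_inv, hf σ hσ]

/-- **The `hfix` reduction**: if `f′ · c = f` in `O^×(A^birat)` with `f` and `c` both `H_A`-fixed, then `f′` is `H_A`-fixed (apply to
`A := A_N`, `f′ := (α′)^* f′_twist`, `c := (α′ ≫ s″)^*(u_u)`, `f := (α′)^* f` via the multiplicativity of `pullFracModel` and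
`fracOfModel_twistUnit_mul`).  [cite: MochizukiEtTh2009, Def 4.1 (iii) p.313 (PDF p.87)] -/
theorem isFixedByHA_of_mul_eq {f f' c : S.biratUnits A} (h : f' * c = f) (hf : S.IsFixedByHA A hA f)
    (hc : S.IsFixedByHA A hA c) : S.IsFixedByHA A hA f' := by
  have hf' : f' = f * c⁻¹ := eq_mul_inv_of_mul_eq h
  rw [hf']
  exact hf.mul hc.inv

end Fixed

end BiKummerSetting

end Literature.AnabelianGeometry.EtaleTheta

end
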